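import Summits.RiemannHypothesis.RiemannHypothesis.Theses.SignCone
import Summits.RiemannHypothesis.RiemannHypothesis.Theorems.SignConeSignConeOscillatoryEnvelope
import Summits.RiemannHypothesis.RiemannHypothesis.Theorems.SignConeEnvelopeCutoff
import Literature.NumberTheory.LFunctions.WeilExplicit
import Literature.NumberTheory.LFunctions.WeilExplicitProofs
import Literature.NumberTheory.LFunctions.WeilExplicitContinuous
import Literature.NumberTheory.LFunctions.WeilArchimedeanPositivityProofs
import Literature.NumberTheory.LFunctions.UniformWeilPositivityRH
import Literature.NumberTheory.LFunctions.WeilExplicitArchTermProofs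
import Literature.NumberTheory.LFunctions.WeilMellinBounds
import Mathlib.Analysis.SpecialFunctions.Trigonometric.DerivHyp
import HarnessLib

/-!
# Disproof of `SignConeFarField` — findings (cdisprove, crux stmt-RiemannHypothesis-16305, route SignCone)

Crux (support item, rank 9): for every cutoff `a > 0` and every `F = Σᵢ gᵢ ⋆ g̃ᵢ` (`gᵢ` smooth,
`tsupport gᵢ ⊆ [-a, a]`) that is non-negative at the nodes (`Re F(log n) ≥ 0`, `n ≥ 2`) AND in the whole
far field (`Re F(t) ≥ 0` for `|t| ≥ log 2`), the polar-plus-archimedean part of Weil's functional obeys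
`Re W_ar(F) ≥ -Re F(0)`, `W_ar = weilPolarTerm + weilArchTerm` (the item's `M`-form is DEFINITIONALLY
the Literature form, `signConeFarField_iff_lit`).

## Verdict of this cycle: NO KILL — the crux is RH-implied (kernel-checked) and unconditionally in reach

* `signConeFarField_of_riemannHypothesis` (tree, `Theorems/SignConeSignConeOscillatoryEnvelope.lean`,
  axioms `propext/Classical.choice/Quot.sound`): `RiemannHypothesis → SignConeFarField`. Hence ANY
  refutation of the crux is a disproof of RH; no mis-formalisation can make it false "for the wrong
  reason". Re-exported below together with the EXACT strengthening `0 ≤ Re W_ar(F)` (also RH-implied,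
  `signConeFarFieldExact_of_riemannHypothesis`) — the unit slack `-F(0)` is not needed under RH.
* Unconditional regime: for `a ≤ (log 3)/2` the exact form holds (`signConeFarFieldExact_upTo_log_three_half`,
  from the tree's first-prime Weil positivity).
* The route's crude bookkeeping constant is CONFIRMED numerically (this folder, `consts.py`, pure-python
  Simpson `n = 2·10⁵` + closed forms; kit job j020425 part A at 30 digits):
  `t_w = 0.2811996` (root of `w(t) = 2cosh(t/2) - e^{t/2}/(2 sinh t)`; NB `e^{t_w}` is the plastic
  number, real root of `y³ = y + 1`), `∫₀^{log 2}(2w + 1/sinh) = 2.4595779 = 8 sinh((log 2)/2) - J`,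
  `J = [-2 log(x+1) + log(x²+1) + 2 arctan x]₁^{√2} = 0.3688492`, `4∫_{t_w}^{log 2} w = 1.2126758`,
  `∫_{log 2}^∞ dt/sinh t = log 3`, `log 4π + γ = 3.1082399`; total `-0.7627255 > -1` (margin `0.237`).
  So the unconditional proof by weight bookkeeping has an O(1) margin; no normalisation slip exists
  (the digamma form, Bombieri's form and the explicit formula are all theorems of the tree:
  `weilArchTermBombieri_eq_weilArchTerm_holds`, `explicit_formula_holds`).

## Load-bearing analysis (which hypotheses any proof must use)

* (H_nodes) `Re F(log n) ≥ 0` is DECORATION: it is implied by the far-field hypothesis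
  (`log n ≥ log 2` for `n ≥ 2`): `signConeFarField_iff_noNodes`.
* (H_ff) the far-field sign is the whole point: dropping it gives the route TARGET `SignConeInequality`
  (RH-equivalent by the 2001 duality + magnification theorems; tree: `signConeFarField_of_signConeInequality`).
  Not testable cheaply; no claim.
* (H_pd) positive-definiteness (the autocorrelation structure `F = Σ gᵢ ⋆ g̃ᵢ`) IS load-bearing:
  `signConeFarField_false_without_PD` — for general smooth compactly supported `F` with the same sign
  pattern the inequality fails (witness `F = -(b ⋆ b̃)`, `b` a bump of radius `1/3 ≤ (log 2)/2`: it is `0`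
  at every node and in the far field, and `Re W_ar(b ⋆ b̃) ≥ 0` by Yoshida's theorem
  `weilPositivityOn_of_le_log_two_half`, so `Re W_ar(F) ≤ 0 < -Re F(0)` would be needed).
  SHARPER (`signConeFarField_false_without_PD_nonneg`, §2b'): even keeping `F` hermitian AND `Re F ≥ 0`
  EVERYWHERE the statement fails — witness two positive bumps at `±7/50` and nothing at the origin
  (`F₀(0) = 0`, `Re W_ar(F₀) ≤ -(1/5)∫Γ < 0`): the bookkeeping weight `w(t) < 0` on `(0, t_w)` as a theorem.
  What the bookkeeping proof actually uses of (H_pd) is exactly: `F` hermitian and `|F(t)| ≤ Re F(0)`;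
  so the minimal sufficient repaired hypothesis is `∀ t, ‖F t‖ ≤ (F 0).re` (that IS the crux's own proof).
* (H_both) dropping BOTH sign hypotheses gives plain "`Re W_ar ≥ -F(0)` on the Weil cone", which is
  false from cutoff `a ≈ 1.1` on (kit job j020425 part D, LP over the Fejér–Riesz cone of autocorrelations
  of hat-spline series, knot `h`; values of `inf Re W_ar(F)/F(0)`, class `nosign`: `a = 0.5: -0.20`,
  `0.75: -0.62`, `1.0: -0.91`, `1.5: -2.20`, `2.0: -3.96`, `2.5: -6.77`); near-miss recorded as
  `signCone_false_without_signs` (sorry: a Lean witness needs certified evaluation of `W_ar`).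

## Tightness

Under RH the far-field class even satisfies `Re W_ar(F) ≥ Re P_Λ(F) ≥ 0`, so the constant `-1` of the
crux is far from sharp. Numerically (job j020425 part D, same LP; evidence `compute-j020425.json` on the
item) `inf Re W_ar(F)/F(0)` on the FAR-FIELD class is `≈ 0⁺` at every cutoff tried (`a = 0.35: +0.012`,
`0.5: +0.005`, `0.75 … 2.5: +0.02 … +0.0006`, relaxed LP values `≥ -2·10⁻⁴`), i.e. the exact form is
numerically TIGHT AT 0 and the unit slack is entirely unused; the optimisers are negative exactly on
`(0.23, log 2)` (between `t_w` and the first node), as the bookkeeping predicts. Calibration for the sibling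
crux: on the full sign cone (nodes only) the infimum is also `≈ 0⁺` up to `a = 2.5` (`x = e^{2a} ≤ 148`).
Normalisation cross-checks (parts B/C): digamma form = Bombieri form to `10⁻²⁰`; explicit formula
`W_ar(F) - P_Λ(F) = Σ_ρ F̂(ρ)` verified to `10⁻¹⁵` on `e^{-u²}` and `e^{-u²/4}cos(γ₁u)` (29 zeros).
-/

noncomputable section

-- every Cruxes/Theorems file of this sub-problem declares into `Summit.RiemannHypothesis.RiemannHypothesis.…`
set_option linter.dupNamespace false

open scoped BigOperators ComplexConjugate
open Complex MeasureTheory Set Filter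

namespace Summit.RiemannHypothesis.RiemannHypothesis.Cruxes.SignConeFarField.Disproof

open Literature.NumberTheory.LFunctions
open Summit.RiemannHypothesis.RiemannHypothesis.Theses.SignCone
open Summit.RiemannHypothesis.RiemannHypothesis.Theorems.SignCone

/-! ## 0. The crux in Literature vocabulary -/

/-- The crux restated over `Literature.NumberTheory.LFunctions` vocabulary (definitionally equal to the
route decl, `signConeFarField_iff_lit`). [folklore] -/
def SignConeFarFieldLit : Prop :=
  ∀ a : ℝ, 0 < a → ∀ (k : ℕ) (g : Fin k → ℝ → ℂ),
    (∀ i, IsWeilTest (g i) ∧ tsupport (g i) ⊆ Icc (-a) a) →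
    let F : ℝ → ℂ := fun t => ∑ i, weilConv (g i) (weilReflect (g i)) t;
    (∀ n : ℕ, 2 ≤ n → 0 ≤ (F (Real.log n)).re) →
    (∀ t : ℝ, Real.log 2 ≤ |t| → 0 ≤ (F t).re) →
    -(F 0).re ≤ (weilPolarTerm F + weilArchTerm F).re

/-- The route decl IS the Literature form (`Iff.rfl`): `IsWeilTest`, `weilConv`, `weilReflect`,
`weilMellin`, `weilPolarTerm`, `weilArchTerm` unfold to the item's Mathlib primitives. [folklore] -/
theorem signConeFarField_iff_lit : SignConeFarField ↔ SignConeFarFieldLit := Iff.rfl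

/-! ## 1. Why it resists: the crux is RH-implied, even without the unit slack -/

/-- **RH ⇒ crux** (tree theorem, re-exported for the reader of this file). [folklore] -/
theorem signConeFarField_of_riemannHypothesis' (hRH : RiemannHypothesis) : SignConeFarField :=
  signConeFarField_of_riemannHypothesis hRH

/-- The EXACT strengthening of the crux: conclusion `0 ≤ Re W_ar(F)` (no slack). [folklore] -/
def SignConeFarFieldExact : Prop :=
  ∀ a : ℝ, 0 < a → ∀ (k : ℕ) (g : Fin k → ℝ → ℂ),
    (∀ i, IsWeilTest (g i) ∧ tsupport (g i) ⊆ Icc (-a) a) →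
    let F : ℝ → ℂ := fun t => ∑ i, weilConv (g i) (weilReflect (g i)) t;
    (∀ n : ℕ, 2 ≤ n → 0 ≤ (F (Real.log n)).re) →
    (∀ t : ℝ, Real.log 2 ≤ |t| → 0 ≤ (F t).re) →
    0 ≤ (weilPolarTerm F + weilArchTerm F).re

/-- `WeilPositivity →` exact far-field inequality (`Re W_ar = Σ Re Q(gᵢ) + Re P_Λ ≥ 0`). [folklore] -/
theorem signConeFarFieldExact_of_weilPositivity (hWP : WeilPositivity) : SignConeFarFieldExact := by
  intro a _ha k g hg F hn _hff
  exact re_weilArchPolar_nonneg (g := g) (F := F) rfl (fun i => (hg i).1) (fun i => hWP _ (hg i).1) hn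

/-- **RH ⇒ the EXACT far-field inequality**: under RH the unit slack of the crux is not used at all.
[folklore] -/
theorem signConeFarFieldExact_of_riemannHypothesis (hRH : RiemannHypothesis) : SignConeFarFieldExact :=
  signConeFarFieldExact_of_weilPositivity (WeilPositivity.of_riemannHypothesis explicit_formula_holds hRH)

/-- The exact form implies the crux (`Re F(0) = Σ ‖gᵢ‖₂² ≥ 0`). [folklore] -/
theorem signConeFarField_of_exact (h : SignConeFarFieldExact) : SignConeFarField := by
  intro a ha k g hg F hn hff
  have h1 : 0 ≤ (weilPolarTerm F + weilArchTerm F).re := h a ha k g hg hn hff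
  have h0 : 0 ≤ (F 0).re := re_apply_zero_nonneg (g := g) (F := F) rfl
  have : -(F 0).re ≤ (weilPolarTerm F + weilArchTerm F).re := by linarith
  exact this

/-- **Unconditional regime**: for cutoffs `a ≤ (log 3)/2` the exact far-field inequality holds
(first-prime Weil positivity of the tree, `re_weilArchPolar_nonneg_of_le_log_three_half`). [folklore] -/
theorem signConeFarFieldExact_upTo_log_three_half :
    ∀ a : ℝ, 0 < a → a ≤ Real.log 3 / 2 → ∀ (k : ℕ) (g : Fin k → ℝ → ℂ),
      (∀ i, IsWeilTest (g i) ∧ tsupport (g i) ⊆ Icc (-a) a) →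
      let F : ℝ → ℂ := fun t => ∑ i, weilConv (g i) (weilReflect (g i)) t;
      (∀ n : ℕ, 2 ≤ n → 0 ≤ (F (Real.log n)).re) →
      0 ≤ (weilPolarTerm F + weilArchTerm F).re := by
  intro a _ha ha3 k g hg F hn
  exact re_weilArchPolar_nonneg_of_le_log_three_half ha3 (g := g) (F := F) rfl (fun i => (hg i).1)
    (fun i => (hg i).2) hn

/-! ## 2. Load-bearing hypotheses

### 2a. The node hypothesis is decoration -/

/-- Far-field non-negativity implies node non-negativity (`|log n| = log n ≥ log 2` for `n ≥ 2`).
[folklore] -/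
theorem nodes_of_farField {F : ℝ → ℂ} (hff : ∀ t : ℝ, Real.log 2 ≤ |t| → 0 ≤ (F t).re) :
    ∀ n : ℕ, 2 ≤ n → 0 ≤ (F (Real.log n)).re := by
  intro n hn
  refine hff _ ?_
  have h2 : (2 : ℝ) ≤ n := by exact_mod_cast hn
  have hlog : Real.log 2 ≤ Real.log n := Real.log_le_log (by norm_num) h2
  exact hlog.trans (le_abs_self _)

/-- The crux WITHOUT the node hypothesis (Mathlib primitives, verbatim otherwise). [folklore] -/
def SignConeFarFieldNoNodes : Prop :=
  ∀ a : ℝ, 0 < a → ∀ (k : ℕ) (g : Fin k → ℝ → ℂ), (∀ i, (ContDiff ℝ ((⊤ : ℕ∞) : WithTop ℕ∞) (g i) ∧ HasCompactSupport (g i)) ∧ tsupport (g i) ⊆ Set.Icc (-a) a) → let F : ℝ → ℂ := fun t => ∑ i, MeasureTheory.convolution (g i) (fun u => (starRingEnd ℂ) ((g i) (-u))) (ContinuousLinearMap.mul ℂ ℂ) MeasureTheory.MeasureSpace.volume t; (∀ t : ℝ, Real.log 2 ≤ |t| → 0 ≤ (F t).re) → let M : ℂ → ℂ := fun s => ∫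 u : ℝ, F u * Complex.exp ((s - 1 / 2) * u); -(F 0).re ≤ (M 0 + M 1 + ((1 / (2 * Real.pi) : ℂ) * (∫ t : ℝ, M (1 / 2 + t * Complex.I) * ((Complex.digamma (1 / 4 + t / 2 * Complex.I)).re : ℂ)) - F 0 * (Real.log Real.pi : ℂ))).re

/-- **(H_nodes) is decoration**: the crux is equivalent to its node-free form. [folklore] -/
theorem signConeFarField_iff_noNodes : SignConeFarField ↔ SignConeFarFieldNoNodes :=
  ⟨fun h a ha k g hg hff => h a ha k g hg (nodes_of_farField hff) hff,
   fun h a ha k g hg _hn hff => h a ha k g hg hff⟩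

/-! ### 2b. Positive-definiteness is load-bearing -/

/-- The crux with the autocorrelation structure DROPPED: `F` an arbitrary smooth function supported in
`[-2a, 2a]` (where `Σ gᵢ ⋆ g̃ᵢ` would live), same sign hypotheses, same conclusion. FALSE
(`signConeFarField_false_without_PD`). [folklore] -/
def SignConeFarFieldWithoutPD : Prop :=
  ∀ a : ℝ, 0 < a → ∀ F : ℝ → ℂ, (ContDiff ℝ ((⊤ : ℕ∞) : WithTop ℕ∞) F ∧ HasCompactSupport F) ∧ tsupport F ⊆ Set.Icc (-(2 * a)) (2 * a) → (∀ n : ℕ, 2 ≤ n → 0 ≤ (F (Real.log n)).re) → (∀ t : ℝ, Real.log 2 ≤ |t| → 0 ≤ (F t).re) → let M : ℂ → ℂ := fun s => ∫ u : ℝ, F u * Complex.exp ((s - 1 / 2) * u); -(F 0).re ≤ (M 0 + M 1 + ((1 / (2 * Real.pi) : ℂ) * (∫ t : ℝ, M (1 / 2 + t * Complex.I) * ((Complex.digamma (1 / 4 + t / 2 * Complex.I)).re : ℂ)) - F 0 * (Real.log Real.pi : ℂ))).re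

/-- `rOut (bump 2) = 1/3`. [folklore] -/
theorem bump2_rOut : (WeilContinuous.bump 2).rOut = 1 / 3 := by
  rw [WeilContinuous.bump_rOut]
  norm_num

/-- `b(x) = 0` for `|x| ≥ 1/3`. [folklore] -/
theorem bump2_eq_zero {x : ℝ} (hx : 1 / 3 ≤ |x|) : (WeilContinuous.bump 2) x = 0 := by
  apply (WeilContinuous.bump 2).zero_of_le_dist
  rwa [bump2_rOut, Real.dist_eq, sub_zero]

/-- `b(0) = 1`. [folklore] -/
theorem bump2_zero : (WeilContinuous.bump 2) 0 = 1 :=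
  (WeilContinuous.bump 2).one_of_mem_closedBall (Metric.mem_closedBall_self (WeilContinuous.bump 2).rIn_pos.le)

/-- The bump as a complex test function. [folklore] -/
theorem isWeilTest_bump2 : IsWeilTest (fun u : ℝ => (((WeilContinuous.bump 2) u : ℝ) : ℂ)) :=
  ⟨Complex.ofRealCLM.contDiff.comp (WeilContinuous.bump 2).contDiff,
   (WeilContinuous.bump 2).hasCompactSupport.comp_left (g := fun r : ℝ => (r : ℂ)) Complex.ofReal_zero⟩

/-- `2/3 ≤ log 2`. [folklore] -/
theorem two_thirds_le_log_two : (2 / 3 : ℝ) ≤ Real.log 2 := by linarith [Real.log_two_gt_d9]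

/-- `tsupport b ⊆ [-(log 2)/2, (log 2)/2]` (`rOut = 1/3 ≤ (log 2)/2`). [folklore] -/
theorem tsupport_bump2_subset :
    tsupport (fun u : ℝ => (((WeilContinuous.bump 2) u : ℝ) : ℂ)) ⊆ Icc (-(Real.log 2 / 2)) (Real.log 2 / 2) := by
  refine closure_minimal (fun x hx => ?_) isClosed_Icc
  rw [Function.mem_support] at hx
  by_contra h
  rw [mem_Icc, not_and_or, not_le, not_le] at h
  refine hx ?_
  have h13 : 1 / 3 ≤ |x| := by
    rcases h with h | h
    · rw [abs_of_neg (by linarith [two_thirds_le_log_two])]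
      linarith [two_thirds_le_log_two]
    · rw [abs_of_pos (by linarith [two_thirds_le_log_two])]
      linarith [two_thirds_le_log_two]
  simp [bump2_eq_zero h13]

/-- The autocorrelation `G = b ⋆ b̃` as an integral of a REAL non-negative integrand:
`G(t) = ∫ b(u) b(u - t) du`. [folklore] -/
theorem weilConv_bump2_apply (t : ℝ) :
    weilConv (fun u : ℝ => (((WeilContinuous.bump 2) u : ℝ) : ℂ))
        (weilReflect (fun u : ℝ => (((WeilContinuous.bump 2) u : ℝ) : ℂ))) t =
      ((∫ u : ℝ, (WeilContinuous.bump 2) u * (WeilContinuous.bump 2) (u - t) : ℝ) : ℂ) := by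
  rw [weilConv_apply, ← integral_complex_ofReal]
  refine integral_congr_ae (Eventually.of_forall fun u => ?_)
  simp only [weilReflect, neg_sub, Complex.conj_ofReal, Complex.ofReal_mul]

/-- `G(t) = 0` for `|t| ≥ 2/3`: the bumps `b(u)` and `b(u - t)` have disjoint supports. [folklore] -/
theorem weilConv_bump2_eq_zero {t : ℝ} (ht : 2 / 3 ≤ |t|) :
    weilConv (fun u : ℝ => (((WeilContinuous.bump 2) u : ℝ) : ℂ))
        (weilReflect (fun u : ℝ => (((WeilContinuous.bump 2) u : ℝ) : ℂ))) t = 0 := by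
  rw [weilConv_bump2_apply]
  have h : ∀ u : ℝ, (WeilContinuous.bump 2) u * (WeilContinuous.bump 2) (u - t) = 0 := by
    intro u
    by_cases hu : 1 / 3 ≤ |u|
    · rw [bump2_eq_zero hu, zero_mul]
    · push Not at hu
      have hut : 1 / 3 ≤ |u - t| := by
        have h1 : |t| - |u| ≤ |u - t| := by
          have := abs_sub_abs_le_abs_sub t u
          rwa [abs_sub_comm] at this
        linarith
      rw [bump2_eq_zero hut, mul_zero]
  simp [h]

/-- `Re G(0) = ∫ b² > 0`. [folklore] -/
theorem re_weilConv_bump2_zero_pos :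
    0 < (weilConv (fun u : ℝ => (((WeilContinuous.bump 2) u : ℝ) : ℂ))
        (weilReflect (fun u : ℝ => (((WeilContinuous.bump 2) u : ℝ) : ℂ))) 0).re := by
  rw [weilConv_bump2_apply, Complex.ofReal_re]
  simp only [sub_zero]
  have hc : Continuous fun u : ℝ => (WeilContinuous.bump 2) u * (WeilContinuous.bump 2) u :=
    (WeilContinuous.bump 2).continuous.mul (WeilContinuous.bump 2).continuous
  have hsupp : HasCompactSupport fun u : ℝ => (WeilContinuous.bump 2) u * (WeilContinuous.bump 2) u :=
    (WeilContinuous.bump 2).hasCompactSupport.mul_left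
  refine integral_pos_of_integrable_nonneg_nonzero (x := 0) hc (hc.integrable_of_hasCompactSupport hsupp)
    (fun u => mul_nonneg ((WeilContinuous.bump 2).nonneg) ((WeilContinuous.bump 2).nonneg)) ?_
  simp [bump2_zero]

/-- `W_ar(-F) = -W_ar(F)` (no hypotheses: `∫ -f = -∫ f` unconditionally). [folklore] -/
theorem weilArchPolar_neg (F : ℝ → ℂ) :
    weilPolarTerm (fun t => -F t) + weilArchTerm (fun t => -F t) = -(weilPolarTerm F + weilArchTerm F) := by
  have hM : ∀ s, weilMellin (fun t => -F t) s = -weilMellin F s := by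
    intro s
    have e : (fun t : ℝ => -F t) = fun t => (-1 : ℂ) * F t := by funext t; ring
    rw [e, weilMellin_const_mul]
    ring
  have hA : weilArchIntegral (fun t => -F t) = -weilArchIntegral F := by
    unfold weilArchIntegral
    rw [← integral_neg]
    refine integral_congr_ae (Eventually.of_forall fun t => ?_)
    simp only [hM]
    ring
  simp only [weilPolarTerm, weilArchTerm, hM, hA]
  ring

/-- **(H_pd) is load-bearing: `SignConeFarFieldWithoutPD` is FALSE.** Witness `F = -(b ⋆ b̃)` with `b` the
bump of radius `1/3`: `F` is smooth, supported in `[-2/3, 2/3] ⊆ [-2a, 2a]` (`a = 1`), vanishes at every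
node and on the far field (`2/3 ≤ log 2`), but `Re W_ar(b ⋆ b̃) ≥ 0` (Yoshida: `WeilPositivityOn ((log 2)/2)`,
tree theorem `weilPositivityOn_of_le_log_two_half`, through `re_weilArchPolar_nonneg_of_weilPositivityOn`)
and `Re (b ⋆ b̃)(0) = ∫ b² > 0`, so `-Re F(0) = ∫ b² > 0 ≥ -Re W_ar(b ⋆ b̃) = Re W_ar(F)`. Any proof of the
crux must use the cone structure of `F` (at least `Re F(0) ≥ 0`; the bookkeeping proof uses exactly
`F` hermitian and `|F| ≤ Re F(0)`). [folklore] -/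
theorem signConeFarField_false_without_PD : ¬ SignConeFarFieldWithoutPD := by
  intro h
  set b : ℝ → ℂ := fun u : ℝ => (((WeilContinuous.bump 2) u : ℝ) : ℂ) with hb
  set G : ℝ → ℂ := weilConv b (weilReflect b) with hGdef
  have hbt : IsWeilTest b := isWeilTest_bump2
  have hGt : IsWeilTest G := hbt.weilConv hbt.weilReflect
  have hGsupp : tsupport G ⊆ Icc (-(2 * (Real.log 2 / 2))) (2 * (Real.log 2 / 2)) :=
    tsupport_weilConv_weilReflect_subset hbt.2 tsupport_bump2_subset
  set F : ℝ → ℂ := fun t => -G t with hFdef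
  have hFt : IsWeilTest F := by
    have e : F = fun t => (-1 : ℂ) * G t := by funext t; simp [hFdef]
    rw [e]
    exact hGt.const_mul (-1)
  have hFsupp : tsupport F ⊆ Icc (-(2 * (1 : ℝ))) (2 * 1) := by
    have e : F = fun t => (-1 : ℂ) * G t := by funext t; simp [hFdef]
    have h1 : tsupport F ⊆ tsupport G := by
      rw [e]
      exact tsupport_mul_subset_right
    refine h1.trans (hGsupp.trans ?_)
    intro x hx
    simp only [mem_Icc] at hx ⊢
    constructor <;> nlinarith [Real.log_two_lt_d9]
  have hGzero : ∀ t : ℝ, Real.log 2 ≤ |t| → G t = 0 := fun t ht =>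
    weilConv_bump2_eq_zero (two_thirds_le_log_two.trans ht)
  have hnodes : ∀ n : ℕ, 2 ≤ n → 0 ≤ (F (Real.log n)).re := by
    intro n hn
    have h2 : (2 : ℝ) ≤ n := by exact_mod_cast hn
    have hlog : Real.log 2 ≤ |Real.log n| :=
      (Real.log_le_log (by norm_num) h2).trans (le_abs_self _)
    simp [hFdef, hGzero _ hlog]
  have hff : ∀ t : ℝ, Real.log 2 ≤ |t| → 0 ≤ (F t).re := by
    intro t ht
    simp [hFdef, hGzero _ ht]
  -- the (false) inequality at the witness
  have key : -(F 0).re ≤ (weilPolarTerm F + weilArchTerm F).re := h 1 one_pos F ⟨hFt, hFsupp⟩ hnodes hff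
  -- `Re W_ar(G) ≥ 0` by Yoshida's small-support positivity, and `W_ar(F) = -W_ar(G)`
  have hGpos : 0 ≤ (weilPolarTerm G + weilArchTerm G).re := by
    have hdec : weilPolarTerm G + weilArchTerm G = weilFunctional G + weilPrimeTerm G := by
      unfold weilFunctional
      ring
    have hQ : 0 ≤ (weilFunctional G).re :=
      weilPositivityOn_of_le_log_two_half le_rfl b hbt tsupport_bump2_subset
    have hsym : ∀ t : ℝ, conj (G (-t)) = G t := fun t => conj_weilConv_weilReflect_neg b t
    have hP : 0 ≤ (weilPrimeTerm G).re := by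
      refine re_weilPrimeTerm_nonneg hGt.2 hsym fun n hn => ?_
      have h2 : (2 : ℝ) ≤ n := by exact_mod_cast hn
      have hlog : Real.log 2 ≤ |Real.log n| :=
        (Real.log_le_log (by norm_num) h2).trans (le_abs_self _)
      rw [hGzero _ hlog, Complex.zero_re]
    rw [hdec, Complex.add_re]
    exact add_nonneg hQ hP
  have hneg : weilPolarTerm F + weilArchTerm F = -(weilPolarTerm G + weilArchTerm G) := weilArchPolar_neg G
  have hF0 : (F 0).re = -(G 0).re := by simp [hFdef]
  have hG0 : 0 < (G 0).re := re_weilConv_bump2_zero_pos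
  rw [hneg, hF0, Complex.neg_re] at key
  linarith

/-! ### 2b'. Even `F ≥ 0` everywhere does not save it: the ORIGIN MUST DOMINATE

`signConeFarField_false_without_PD_nonneg` (landed as `Theorems/SignConeFarField/Negative/OriginDominates.lean`
+ `BumpAutocorrelation.lean`, proposals p129353 / part 2 to follow): replacing the autocorrelation structure by
"`F` smooth, supported in `[-2a, 2a]`, hermitian, `Re F ≥ 0` EVERYWHERE" still gives a FALSE statement.
Witness `F₀ = Γ(· - 7/50) + Γ(· + 7/50)`, `Γ = b ⋆ b` (bump of radius `1/20`): `F₀(0) = 0` and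
`Re W_ar(F₀) = ∫ Γ(t - 7/50) K(t) dt ≤ -(1/5)∫Γ < 0`, `K(t) = 2(e^{-t/2} + e^{t/2}) - e^{t/2}/sinh t = 2w(t) ≤ -1/5`
on `(0, 6/25]`. This is the bookkeeping weight `w < 0` on `(0, t_w)` made into a theorem: mass near (but not at)
the origin has NEGATIVE archimedean-plus-polar energy, so `|F(t)| ≤ Re F(0)` is exactly the load-bearing input. -/

/-! #### The bump of radius `1/20` and its real autocorrelation `Γ` -/

/-- `rOut (bump 19) = 1/20`. [folklore] -/
theorem bump19_rOut : (WeilContinuous.bump 19).rOut = 1 / 20 := by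
  rw [WeilContinuous.bump_rOut]
  norm_num

/-- `b(x) = 0` for `|x| ≥ 1/20`. [folklore] -/
theorem bump19_eq_zero {x : ℝ} (hx : 1 / 20 ≤ |x|) : (WeilContinuous.bump 19) x = 0 := by
  apply (WeilContinuous.bump 19).zero_of_le_dist
  rwa [bump19_rOut, Real.dist_eq, sub_zero]

/-- `b(0) = 1`. [folklore] -/
theorem bump19_zero : (WeilContinuous.bump 19) 0 = 1 :=
  (WeilContinuous.bump 19).one_of_mem_closedBall
    (Metric.mem_closedBall_self (WeilContinuous.bump 19).rIn_pos.le)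

/-- The bump as a complex Weil test function. [folklore] -/
theorem isWeilTest_bump19 : IsWeilTest (fun u : ℝ => (((WeilContinuous.bump 19) u : ℝ) : ℂ)) :=
  ⟨Complex.ofRealCLM.contDiff.comp (WeilContinuous.bump 19).contDiff,
   (WeilContinuous.bump 19).hasCompactSupport.comp_left (g := fun r : ℝ => (r : ℂ)) Complex.ofReal_zero⟩

/-- The real autocorrelation `Γ(t) = ∫ b(u) b(u - t) du` of the bump. [folklore] -/
def gam (t : ℝ) : ℝ := ∫ u : ℝ, (WeilContinuous.bump 19) u * (WeilContinuous.bump 19) (u - t)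

/-- `b ⋆ b̃ = Γ` (as a complex function). [folklore] -/
theorem weilConv_bump19_apply (t : ℝ) :
    weilConv (fun u : ℝ => (((WeilContinuous.bump 19) u : ℝ) : ℂ))
        (weilReflect (fun u : ℝ => (((WeilContinuous.bump 19) u : ℝ) : ℂ))) t = ((gam t : ℝ) : ℂ) := by
  rw [gam, weilConv_apply, ← integral_complex_ofReal]
  refine integral_congr_ae (Eventually.of_forall fun u => ?_)
  simp only [weilReflect, neg_sub, Complex.conj_ofReal, Complex.ofReal_mul]

/-- `Γ ≥ 0`. [folklore] -/
theorem gam_nonneg (t : ℝ) : 0 ≤ gam t :=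
  integral_nonneg fun _ => mul_nonneg (WeilContinuous.bump 19).nonneg (WeilContinuous.bump 19).nonneg

/-- `Γ(t) = 0` for `|t| ≥ 1/10` (the bumps `b(u)`, `b(u - t)` have disjoint supports). [folklore] -/
theorem gam_eq_zero {t : ℝ} (ht : 1 / 10 ≤ |t|) : gam t = 0 := by
  have h : ∀ u : ℝ, (WeilContinuous.bump 19) u * (WeilContinuous.bump 19) (u - t) = 0 := by
    intro u
    by_cases hu : 1 / 20 ≤ |u|
    · rw [bump19_eq_zero hu, zero_mul]
    · push Not at hu
      have hut : 1 / 20 ≤ |u - t| := by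
        have h1 : |t| - |u| ≤ |u - t| := by
          have := abs_sub_abs_le_abs_sub t u
          rwa [abs_sub_comm] at this
        linarith
      rw [bump19_eq_zero hut, mul_zero]
  simp [gam, h]

/-- `Γ(0) = ∫ b² > 0`. [folklore] -/
theorem gam_zero_pos : 0 < gam 0 := by
  simp only [gam, sub_zero]
  have hc : Continuous fun u : ℝ => (WeilContinuous.bump 19) u * (WeilContinuous.bump 19) u :=
    (WeilContinuous.bump 19).continuous.mul (WeilContinuous.bump 19).continuous
  have hsupp : HasCompactSupport fun u : ℝ => (WeilContinuous.bump 19) u * (WeilContinuous.bump 19) u :=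
    (WeilContinuous.bump 19).hasCompactSupport.mul_left
  refine integral_pos_of_integrable_nonneg_nonzero (x := 0) hc (hc.integrable_of_hasCompactSupport hsupp)
    (fun u => mul_nonneg (WeilContinuous.bump 19).nonneg (WeilContinuous.bump 19).nonneg) ?_
  simp [bump19_zero]

/-- `Γ` is smooth (real part of the smooth kernel `b ⋆ b̃`). [folklore] -/
theorem contDiff_gam : ContDiff ℝ ((⊤ : ℕ∞) : WithTop ℕ∞) gam := by
  have hG := (isWeilTest_bump19.weilConv isWeilTest_bump19.weilReflect).1
  have e : gam = fun t => Complex.reCLM (weilConv (fun u : ℝ => (((WeilContinuous.bump 19) u : ℝ) : ℂ))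
      (weilReflect (fun u : ℝ => (((WeilContinuous.bump 19) u : ℝ) : ℂ))) t) := by
    funext t
    rw [Complex.reCLM_apply, weilConv_bump19_apply, Complex.ofReal_re]
  rw [e]
  exact Complex.reCLM.contDiff.comp hG

/-- `Γ` is continuous. [folklore] -/
theorem continuous_gam : Continuous gam :=
  contDiff_gam.continuous

/-- `Γ` is even (`b ⋆ b̃` is hermitian and real). [folklore] -/
theorem gam_neg (t : ℝ) : gam (-t) = gam t := by
  have h := conj_weilConv_weilReflect_neg (fun u : ℝ => (((WeilContinuous.bump 19) u : ℝ) : ℂ)) t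
  rw [weilConv_bump19_apply, weilConv_bump19_apply, Complex.conj_ofReal] at h
  exact_mod_cast h

/-- `Γ` has compact support. [folklore] -/
theorem hasCompactSupport_gam : HasCompactSupport gam := by
  refine HasCompactSupport.intro (isCompact_Icc : IsCompact (Icc (-(1 / 10 : ℝ)) (1 / 10))) fun x hx => ?_
  refine gam_eq_zero ?_
  rw [mem_Icc, not_and_or, not_le, not_le] at hx
  rcases hx with h | h
  · rw [abs_of_neg (by linarith)]
    linarith
  · rw [abs_of_pos (by linarith)]
    linarith

/-- `∫ Γ > 0`. [folklore] -/
theorem integral_gam_pos : 0 < ∫ t : ℝ, gam t :=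
  integral_pos_of_integrable_nonneg_nonzero (x := 0) continuous_gam
    (continuous_gam.integrable_of_hasCompactSupport hasCompactSupport_gam) (fun t => gam_nonneg t)
    gam_zero_pos.ne'

/-! #### The witness profile `f₀(t) = Γ(t - 7/50) + Γ(t + 7/50)` -/

/-- The real profile of the witness: two copies of `Γ` centred at `±7/50`. [folklore] -/
def f0 (t : ℝ) : ℝ := gam (t - 7 / 50) + gam (t + 7 / 50)

/-- `f₀ ≥ 0`. [folklore] -/
theorem f0_nonneg (t : ℝ) : 0 ≤ f0 t := add_nonneg (gam_nonneg _) (gam_nonneg _)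

/-- `f₀` is even. [folklore] -/
theorem f0_neg (t : ℝ) : f0 (-t) = f0 t := by
  simp only [f0]
  rw [show -t - 7 / 50 = -(t + 7 / 50) by ring, show -t + 7 / 50 = -(t - 7 / 50) by ring, gam_neg, gam_neg,
    add_comm]

/-- The right copy vanishes for `t ≤ 1/25`. [folklore] -/
theorem gam_shift_eq_zero_of_le {t : ℝ} (ht : t ≤ 1 / 25) : gam (t - 7 / 50) = 0 := by
  refine gam_eq_zero ?_
  rw [abs_of_nonpos (by linarith)]
  linarith

/-- The right copy vanishes for `t ≥ 6/25`. [folklore] -/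
theorem gam_shift_eq_zero_of_ge {t : ℝ} (ht : 6 / 25 ≤ t) : gam (t - 7 / 50) = 0 := by
  refine gam_eq_zero ?_
  rw [abs_of_nonneg (by linarith)]
  linarith

/-- The left copy vanishes for `t ≥ -1/25`. [folklore] -/
theorem gam_shift'_eq_zero_of_ge {t : ℝ} (ht : -(1 / 25) ≤ t) : gam (t + 7 / 50) = 0 := by
  refine gam_eq_zero ?_
  rw [abs_of_nonneg (by linarith)]
  linarith

/-- `f₀(t) = 0` for `|t| ≤ 1/25`: NOTHING at the origin. [folklore] -/
theorem f0_eq_zero_of_abs_le {t : ℝ} (ht : |t| ≤ 1 / 25) : f0 t = 0 := by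
  rw [abs_le] at ht
  rw [f0, gam_shift_eq_zero_of_le ht.2, gam_shift'_eq_zero_of_ge ht.1, add_zero]

/-- `f₀(0) = 0`. [folklore] -/
theorem f0_zero : f0 0 = 0 := f0_eq_zero_of_abs_le (by norm_num)

/-- `f₀(t) = 0` for `|t| ≥ 6/25`. [folklore] -/
theorem f0_eq_zero_of_le_abs {t : ℝ} (ht : 6 / 25 ≤ |t|) : f0 t = 0 := by
  rcases le_abs'.1 ht with h | h
  · have h' : f0 (-t) = 0 := by
      rw [f0, gam_shift_eq_zero_of_ge (by linarith), gam_shift'_eq_zero_of_ge (by linarith), add_zero]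
    rwa [f0_neg] at h'
  · rw [f0, gam_shift_eq_zero_of_ge h, gam_shift'_eq_zero_of_ge (by linarith), add_zero]

/-- For `t > 0` only the right copy is seen: `f₀(t) = Γ(t - 7/50)`. [folklore] -/
theorem f0_of_pos {t : ℝ} (ht : 0 < t) : f0 t = gam (t - 7 / 50) := by
  rw [f0, gam_shift'_eq_zero_of_ge (by linarith), add_zero]

/-- The witness `F₀ = f₀` (as a complex function) is a Weil test function. [folklore] -/
theorem isWeilTest_witness : IsWeilTest (fun t : ℝ => ((f0 t : ℝ) : ℂ)) := by
  constructor
  · have h1 : ContDiff ℝ ((⊤ : ℕ∞) : WithTop ℕ∞) fun t : ℝ => gam (t - 7 / 50) :=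
      contDiff_gam.comp (contDiff_id.sub contDiff_const)
    have h2 : ContDiff ℝ ((⊤ : ℕ∞) : WithTop ℕ∞) fun t : ℝ => gam (t + 7 / 50) :=
      contDiff_gam.comp (contDiff_id.add contDiff_const)
    exact Complex.ofRealCLM.contDiff.comp (h1.add h2)
  · refine HasCompactSupport.intro (isCompact_Icc : IsCompact (Icc (-(1 / 4 : ℝ)) (1 / 4))) fun x hx => ?_
    rw [mem_Icc, not_and_or, not_le, not_le] at hx
    have h0 : f0 x = 0 := by
      refine f0_eq_zero_of_le_abs ?_
      rcases hx with h | h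
      · rw [abs_of_neg (by linarith)]
        linarith
      · rw [abs_of_pos (by linarith)]
        linarith
    simp [h0]

/-- `tsupport F₀ ⊆ [-2, 2]` (indeed `⊆ [-1/4, 1/4]`). [folklore] -/
theorem tsupport_witness_subset :
    tsupport (fun t : ℝ => ((f0 t : ℝ) : ℂ)) ⊆ Icc (-(2 * (1 : ℝ))) (2 * 1) := by
  refine closure_minimal (fun x hx => ?_) isClosed_Icc
  rw [Function.mem_support] at hx
  by_contra h
  rw [mem_Icc, not_and_or, not_le, not_le] at h
  refine hx ?_
  have h0 : f0 x = 0 := by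
    refine f0_eq_zero_of_le_abs ?_
    rcases h with h | h
    · rw [abs_of_neg (by linarith)]
      linarith
    · rw [abs_of_pos (by linarith)]
      linarith
  simp [h0]

open Summit.RiemannHypothesis.RiemannHypothesis.Theses.SignCone

/-! #### `W_ar(F₀)` in closed form -/

/-- The shifted copy `t ↦ Γ(t - 7/50)` has compact support. [folklore] -/
theorem hasCompactSupport_gam_shift : HasCompactSupport fun t : ℝ => gam (t - 7 / 50) := by
  refine HasCompactSupport.intro (isCompact_Icc : IsCompact (Icc (1 / 25 : ℝ) (6 / 25))) fun x hx => ?_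
  rw [mem_Icc, not_and_or, not_le, not_le] at hx
  rcases hx with h | h
  · exact gam_shift_eq_zero_of_le h.le
  · exact gam_shift_eq_zero_of_ge h.le

/-- Integrability of the polar integrand `Γ(t - 7/50)(e^{-t/2} + e^{t/2})`. [folklore] -/
theorem integrable_polar :
    Integrable fun t : ℝ => gam (t - 7 / 50) * (Real.exp (-(t / 2)) + Real.exp (t / 2)) := by
  have hc : Continuous fun t : ℝ => gam (t - 7 / 50) * (Real.exp (-(t / 2)) + Real.exp (t / 2)) :=
    (continuous_gam.comp (continuous_id.sub continuous_const)).mul (by fun_prop)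
  exact hc.integrable_of_hasCompactSupport hasCompactSupport_gam_shift.mul_right

/-- Integrability of the archimedean integrand `e^{t/2} Γ(t - 7/50)/sinh t` (it lives on `[1/25, 6/25]`,
away from the zero of `sinh`). [folklore] -/
theorem integrable_arch :
    Integrable fun t : ℝ => Real.exp (t / 2) * gam (t - 7 / 50) / Real.sinh t := by
  have hsupp : Function.support (fun t : ℝ => Real.exp (t / 2) * gam (t - 7 / 50) / Real.sinh t) ⊆
      Icc (1 / 25) (6 / 25) := by
    intro t ht
    rw [Function.mem_support] at ht
    by_contra hn
    rw [mem_Icc, not_and_or, not_le, not_le] at hn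
    apply ht
    rcases hn with h | h
    · rw [gam_shift_eq_zero_of_le h.le, mul_zero, zero_div]
    · rw [gam_shift_eq_zero_of_ge h.le, mul_zero, zero_div]
  have hcont : ContinuousOn (fun t : ℝ => Real.exp (t / 2) * gam (t - 7 / 50) / Real.sinh t)
      (Icc (1 / 25) (6 / 25)) := by
    have hnum : Continuous fun t : ℝ => Real.exp (t / 2) * gam (t - 7 / 50) :=
      (by fun_prop : Continuous fun t : ℝ => Real.exp (t / 2)).mul
        (continuous_gam.comp (continuous_id.sub continuous_const))
    refine hnum.continuousOn.div Real.continuous_sinh.continuousOn fun t ht => ?_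
    exact (Real.sinh_pos_iff.2 (by linarith [ht.1])).ne'
  exact (integrableOn_iff_integrable_of_support_subset hsupp).1 (hcont.integrableOn_compact isCompact_Icc)

/-- **Polar term of the witness**: `ĝ(0) + ĝ(1) = 2 ∫ Γ(t - 7/50)(e^{-t/2} + e^{t/2}) dt` (the left copy
contributes the same as the right one, by `t ↦ -t`). [folklore] -/
theorem weilPolarTerm_witness :
    weilPolarTerm (fun t : ℝ => ((f0 t : ℝ) : ℂ)) =
      ((2 * ∫ t : ℝ, gam (t - 7 / 50) * (Real.exp (-(t / 2)) + Real.exp (t / 2)) : ℝ) : ℂ) := by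
  have h1 : weilMellin (fun t : ℝ => ((f0 t : ℝ) : ℂ)) 0 = ((∫ t : ℝ, f0 t * Real.exp (-(t / 2)) : ℝ) : ℂ) := by
    rw [weilMellin, ← integral_complex_ofReal]
    refine integral_congr_ae (Eventually.of_forall fun t => ?_)
    dsimp only
    rw [Complex.ofReal_mul, Complex.ofReal_exp]
    congr 2
    push_cast
    ring
  have h2 : weilMellin (fun t : ℝ => ((f0 t : ℝ) : ℂ)) 1 = ((∫ t : ℝ, f0 t * Real.exp (t / 2) : ℝ) : ℂ) := by
    rw [weilMellin, ← integral_complex_ofReal]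
    refine integral_congr_ae (Eventually.of_forall fun t => ?_)
    dsimp only
    rw [Complex.ofReal_mul, Complex.ofReal_exp]
    congr 2
    push_cast
    ring
  -- integrability of the two real integrands
  have hcf : Continuous f0 :=
    (continuous_gam.comp (continuous_id.sub continuous_const)).add
      (continuous_gam.comp (continuous_id.add continuous_const))
  have hsf : HasCompactSupport f0 := by
    refine HasCompactSupport.intro (isCompact_Icc : IsCompact (Icc (-(1 / 4 : ℝ)) (1 / 4))) fun x hx => ?_
    rw [mem_Icc, not_and_or, not_le, not_le] at hx
    refine f0_eq_zero_of_le_abs ?_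
    rcases hx with h | h
    · rw [abs_of_neg (by linarith)]
      linarith
    · rw [abs_of_pos (by linarith)]
      linarith
  have hi1 : Integrable fun t : ℝ => f0 t * Real.exp (-(t / 2)) :=
    (hcf.mul (by fun_prop)).integrable_of_hasCompactSupport hsf.mul_right
  have hi2 : Integrable fun t : ℝ => f0 t * Real.exp (t / 2) :=
    (hcf.mul (by fun_prop)).integrable_of_hasCompactSupport hsf.mul_right
  -- the left copy contributes the same as the right copy
  have hsym : ∫ t : ℝ, gam (t + 7 / 50) * (Real.exp (-(t / 2)) + Real.exp (t / 2)) =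
      ∫ t : ℝ, gam (t - 7 / 50) * (Real.exp (-(t / 2)) + Real.exp (t / 2)) := by
    rw [← integral_neg_eq_self (fun t : ℝ => gam (t + 7 / 50) * (Real.exp (-(t / 2)) + Real.exp (t / 2)))]
    refine integral_congr_ae (Eventually.of_forall fun t => ?_)
    dsimp only
    rw [show -t + 7 / 50 = -(t - 7 / 50) by ring, gam_neg, neg_div, neg_neg, add_comm (Real.exp (t / 2))]
  rw [weilPolarTerm, h1, h2, ← Complex.ofReal_add, ← integral_add hi1 hi2]
  congr 1
  have e : (fun t : ℝ => f0 t * Real.exp (-(t / 2)) + f0 t * Real.exp (t / 2)) =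
      fun t : ℝ => gam (t - 7 / 50) * (Real.exp (-(t / 2)) + Real.exp (t / 2)) +
        gam (t + 7 / 50) * (Real.exp (-(t / 2)) + Real.exp (t / 2)) := by
    funext t
    simp only [f0]
    ring
  have hi3 : Integrable fun t : ℝ => gam (t + 7 / 50) * (Real.exp (-(t / 2)) + Real.exp (t / 2)) := by
    have hc : Continuous fun t : ℝ => gam (t + 7 / 50) * (Real.exp (-(t / 2)) + Real.exp (t / 2)) :=
      (continuous_gam.comp (continuous_id.add continuous_const)).mul (by fun_prop)
    refine hc.integrable_of_hasCompactSupport (HasCompactSupport.mul_right ?_)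
    refine HasCompactSupport.intro (isCompact_Icc : IsCompact (Icc (-(6 / 25) : ℝ) (-(1 / 25)))) fun x hx => ?_
    rw [mem_Icc, not_and_or, not_le, not_le] at hx
    rcases hx with h | h
    · refine gam_eq_zero ?_
      rw [abs_of_neg (by linarith)]
      linarith
    · exact gam_shift'_eq_zero_of_ge h.le
  rw [e, integral_add integrable_polar hi3, hsym]
  ring

/-- **Archimedean term of the witness** (Bombieri's form, `F₀(0) = 0`, `F₀` even, only the right copy on
`t > 0`): `W_∞(F₀) = -∫ e^{t/2} Γ(t - 7/50)/sinh t dt`. [folklore] -/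
theorem weilArchTerm_witness :
    weilArchTerm (fun t : ℝ => ((f0 t : ℝ) : ℂ)) =
      -(((∫ t : ℝ, Real.exp (t / 2) * gam (t - 7 / 50) / Real.sinh t : ℝ) : ℂ)) := by
  rw [← weilArchTermBombieri_eq_weilArchTerm_holds isWeilTest_witness, weilArchTermBombieri]
  have h0 : ((f0 0 : ℝ) : ℂ) = 0 := by rw [f0_zero, Complex.ofReal_zero]
  simp only [h0, mul_zero, zero_add, sub_zero]
  congr 1
  have hpt : EqOn (fun t : ℝ => (Real.exp (t / 2) : ℂ) * (((f0 t : ℝ) : ℂ) + ((f0 (-t) : ℝ) : ℂ)) /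
      (2 * (Real.sinh t : ℂ)))
      (fun t : ℝ => ((Real.exp (t / 2) * gam (t - 7 / 50) / Real.sinh t : ℝ) : ℂ)) (Ioi 0) := by
    intro t ht
    have hf : f0 t + f0 (-t) = 2 * gam (t - 7 / 50) := by
      rw [f0_neg, f0_of_pos ht]
      ring
    dsimp only
    rw [← Complex.ofReal_add, hf]
    push_cast
    ring
  rw [setIntegral_congr_fun measurableSet_Ioi hpt,
    setIntegral_eq_integral_of_forall_compl_eq_zero fun t ht => ?_, integral_complex_ofReal]
  rw [mem_Ioi, not_lt] at ht
  rw [gam_shift_eq_zero_of_le (by linarith), mul_zero, zero_div, Complex.ofReal_zero]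

/-! #### The kernel `K = 2w` is negative near the origin -/

/-- **The weight `K(t) = 2(e^{-t/2} + e^{t/2}) - e^{t/2}/sinh t` is `≤ -1/5` on `(0, 6/25]`.**
With `x = e^{t/2} ∈ (1, 25/22]` (`e^{3/25} ≤ 1/(1 - 3/25)`), `e^{-t/2} = x⁻¹` and
`sinh t = (x² - x⁻²)/2`, the claim is `(10 + 10x² + x)(x⁴ - 1) ≤ 10x⁴`, i.e.
`(10x² + x)(x⁴ - 1) ≤ 10`, and `(10x² + x)(x⁴ - 1) ≤ (10X² + X)(X⁴ - 1) < 9.4` for `X = 25/22`.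
(The sign change of `K` is at `t_w = 0.2812`, `e^{t_w}` the real root of `y³ = y + 1`.) [folklore] -/
theorem kernel_le {t : ℝ} (ht0 : 0 < t) (ht : t ≤ 6 / 25) :
    2 * (Real.exp (-(t / 2)) + Real.exp (t / 2)) - Real.exp (t / 2) / Real.sinh t ≤ -(1 / 5) := by
  set x : ℝ := Real.exp (t / 2) with hx
  have hx0 : 0 < x := Real.exp_pos _
  have hx1 : 1 < x := Real.one_lt_exp_iff.2 (by linarith)
  have hxX : x ≤ 25 / 22 := by
    have h1 : Real.exp (t / 2) ≤ Real.exp (3 / 25) := Real.exp_le_exp.2 (by linarith)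
    have h2 : Real.exp (3 / 25) ≤ 1 / (1 - 3 / 25) :=
      Real.exp_bound_div_one_sub_of_interval (by norm_num) (by norm_num)
    calc x ≤ 1 / (1 - 3 / 25) := h1.trans h2
      _ = 25 / 22 := by norm_num
  have hneg : Real.exp (-(t / 2)) = x⁻¹ := by rw [Real.exp_neg]
  have hexp : Real.exp t = x ^ 2 := by
    rw [hx, sq, ← Real.exp_add, add_halves]
  have hsinh : Real.sinh t = (x ^ 2 - (x ^ 2)⁻¹) / 2 := by
    rw [Real.sinh_eq, Real.exp_neg, hexp]
  rw [hneg, hsinh]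
  have hx4 : 1 < x ^ 4 := one_lt_pow₀ hx1 (by norm_num)
  have hs : 0 < (x ^ 2 - (x ^ 2)⁻¹) / 2 := by
    have h2 : 1 < x ^ 2 := one_lt_pow₀ hx1 (by norm_num)
    have : (x ^ 2)⁻¹ < 1 := inv_lt_one_of_one_lt₀ h2
    linarith
  -- the polynomial inequality
  have h10 : (10 * x ^ 2 + x) * (x ^ 4 - 1) ≤ 10 := by
    have hA : 10 * x ^ 2 + x ≤ 10 * (25 / 22) ^ 2 + 25 / 22 := by nlinarith
    have hB : x ^ 4 - 1 ≤ (25 / 22 : ℝ) ^ 4 - 1 := by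
      have := pow_le_pow_left₀ hx0.le hxX 4
      linarith
    have hB0 : 0 ≤ x ^ 4 - 1 := by linarith
    calc (10 * x ^ 2 + x) * (x ^ 4 - 1) ≤ (10 * (25 / 22) ^ 2 + 25 / 22) * ((25 / 22 : ℝ) ^ 4 - 1) :=
          mul_le_mul hA hB hB0 (by positivity)
      _ ≤ 10 := by norm_num
  have key : 2 * (x⁻¹ + x) + 1 / 5 ≤ x / ((x ^ 2 - (x ^ 2)⁻¹) / 2) := by
    rw [le_div_iff₀ hs]
    have e1 : (2 * (x⁻¹ + x) + 1 / 5) * ((x ^ 2 - (x ^ 2)⁻¹) / 2) =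
        (10 + 10 * x ^ 2 + x) * (x ^ 4 - 1) / (10 * x ^ 3) := by
      field_simp
      ring
    rw [e1, div_le_iff₀ (by positivity)]
    nlinarith [h10]
  linarith

/-! #### The witness violates the inequality -/

/-- **`Re W_ar(F₀) < 0`**: `W_ar(F₀) = ∫ Γ(t - 7/50) K(t) dt ≤ -(1/5) ∫ Γ < 0`. [folklore] -/
theorem re_weilArchPolar_witness_neg :
    (weilPolarTerm (fun t : ℝ => ((f0 t : ℝ) : ℂ)) + weilArchTerm (fun t : ℝ => ((f0 t : ℝ) : ℂ))).re < 0 := by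
  rw [weilPolarTerm_witness, weilArchTerm_witness, ← Complex.ofReal_neg, ← Complex.ofReal_add,
    Complex.ofReal_re]
  set A : ℝ := ∫ t : ℝ, gam (t - 7 / 50) * (Real.exp (-(t / 2)) + Real.exp (t / 2)) with hA
  set B : ℝ := ∫ t : ℝ, Real.exp (t / 2) * gam (t - 7 / 50) / Real.sinh t with hB
  have hcomb : 2 * A - B = ∫ t : ℝ, gam (t - 7 / 50) *
      (2 * (Real.exp (-(t / 2)) + Real.exp (t / 2)) - Real.exp (t / 2) / Real.sinh t) := by
    rw [hA, hB, ← integral_const_mul, ← integral_sub (integrable_polar.const_mul 2) integrable_arch]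
    refine integral_congr_ae (Eventually.of_forall fun t => ?_)
    dsimp only
    ring
  have hI : Integrable fun t : ℝ => gam (t - 7 / 50) *
      (2 * (Real.exp (-(t / 2)) + Real.exp (t / 2)) - Real.exp (t / 2) / Real.sinh t) := by
    refine ((integrable_polar.const_mul 2).sub integrable_arch).congr (Eventually.of_forall fun t => ?_)
    simp only [Pi.sub_apply]
    ring
  have hgi : Integrable fun t : ℝ => gam (t - 7 / 50) :=
    (continuous_gam.comp (continuous_id.sub continuous_const)).integrable_of_hasCompactSupport
      hasCompactSupport_gam_shift
  have hle : ∫ t : ℝ, gam (t - 7 / 50) *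
      (2 * (Real.exp (-(t / 2)) + Real.exp (t / 2)) - Real.exp (t / 2) / Real.sinh t) ≤
      ∫ t : ℝ, -(1 / 5) * gam (t - 7 / 50) := by
    refine integral_mono hI (hgi.const_mul _) fun t => ?_
    dsimp only
    by_cases hg : gam (t - 7 / 50) = 0
    · simp [hg]
    · have ht1 : 1 / 25 < t := by
        by_contra h
        exact hg (gam_shift_eq_zero_of_le (not_lt.1 h))
      have ht2 : t < 6 / 25 := by
        by_contra h
        exact hg (gam_shift_eq_zero_of_ge (not_lt.1 h))
      have hk := kernel_le (by linarith) ht2.le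
      have hg0 : 0 ≤ gam (t - 7 / 50) := gam_nonneg _
      nlinarith [mul_le_mul_of_nonneg_left hk hg0]
  have hint : ∫ t : ℝ, -(1 / 5) * gam (t - 7 / 50) = -(1 / 5) * ∫ t : ℝ, gam t := by
    rw [integral_const_mul, integral_sub_right_eq_self (fun t : ℝ => gam t) (7 / 50)]
  have hpos := integral_gam_pos
  have h2AB : 2 * A + -B < 0 := by linarith
  exact h2AB

/-- **The origin must dominate: `SignConeFarField` without positive-definiteness is FALSE even for
hermitian, everywhere non-negative `F`.** Replacing "`F = Σᵢ gᵢ ⋆ g̃ᵢ`" in the crux by "`F` smooth,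
compactly supported in `[-2a, 2a]`, `F(-t) = conj F(t)`, `Re F ≥ 0` everywhere" (so both sign hypotheses
of the crux hold with room) and keeping the conclusion verbatim gives a false statement: at `a = 1` the
witness `F₀ = Γ(· - 7/50) + Γ(· + 7/50)` has `F₀(0) = 0` but `Re W_ar(F₀) < 0`
(`re_weilArchPolar_witness_neg`). Hence any proof of the crux must use `|F(t)| ≤ Re F(0)` (or more of
positive-definiteness); the far-field sign, the node sign, smoothness, support and hermitian symmetry do
not suffice. [folklore] -/
theorem signConeFarField_false_without_PD_nonneg :
    ¬ (∀ a : ℝ, 0 < a → ∀ F : ℝ → ℂ, (ContDiff ℝ ((⊤ : ℕ∞) : WithTop ℕ∞) F ∧ HasCompactSupport F) ∧ tsupport F ⊆ Set.Icc (-(2 * a)) (2 * a) → (∀ t : ℝ, F (-t) = (starRingEnd ℂ) (F t)) → (∀ t : ℝ, 0 ≤ (F t).re) → let M : ℂ → ℂ := fun s => ∫ u : ℝ, F u * Complex.exp ((s - 1 / 2) * u); -(F 0).re ≤ (M 0 + M 1 + ((1 / (2 * Real.pi) : ℂ) * (∫ t : ℝ, M (1 / 2 + t * Complex.I) * ((Complex.digamma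 (1 / 4 + t / 2 * Complex.I)).re : ℂ)) - F 0 * (Real.log Real.pi : ℂ))).re) := by
  intro h
  have hherm : ∀ t : ℝ, (fun t : ℝ => ((f0 t : ℝ) : ℂ)) (-t) = (starRingEnd ℂ) ((fun t : ℝ => ((f0 t : ℝ) : ℂ)) t) := by
    intro t
    simp only [f0_neg, Complex.conj_ofReal]
  have hnn : ∀ t : ℝ, 0 ≤ ((fun t : ℝ => ((f0 t : ℝ) : ℂ)) t).re := fun t => by
    simp only [Complex.ofReal_re]
    exact f0_nonneg t
  have key : -((fun t : ℝ => ((f0 t : ℝ) : ℂ)) 0).re ≤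
      (weilPolarTerm (fun t : ℝ => ((f0 t : ℝ) : ℂ)) + weilArchTerm (fun t : ℝ => ((f0 t : ℝ) : ℂ))).re :=
    h 1 one_pos _ ⟨isWeilTest_witness, tsupport_witness_subset⟩ hherm hnn
  have h0 : ((fun t : ℝ => ((f0 t : ℝ) : ℂ)) 0).re = 0 := by simp [f0_zero]
  rw [h0, neg_zero] at key
  exact absurd key (not_le.2 re_weilArchPolar_witness_neg)


/-! ### 2c. Both sign hypotheses dropped: false for large cutoffs (numerics only) -/

/-- The crux with BOTH sign hypotheses dropped: `Re W_ar(F) ≥ -Re F(0)` on the whole Weil cone. [folklore] -/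
def SignConeNoSigns : Prop :=
  ∀ a : ℝ, 0 < a → ∀ (k : ℕ) (g : Fin k → ℝ → ℂ),
    (∀ i, IsWeilTest (g i) ∧ tsupport (g i) ⊆ Icc (-a) a) →
    let F : ℝ → ℂ := fun t => ∑ i, weilConv (g i) (weilReflect (g i)) t;
    -(F 0).re ≤ (weilPolarTerm F + weilArchTerm F).re

/-- NEAR-MISS (numerical only). `SignConeNoSigns` is false: without sign constraints the dual weights are
unconstrained and `inf Re W_ar(F)/F(0)` over `P(a)` drops below `-1` at moderate cutoffs (LP over the
Fejér–Riesz cone of autocorrelations of hat-spline series, kit job j020425 part D, class `nosign`; values in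
NOTES.md). A Lean witness needs a certified evaluation of `W_ar` at an explicit oscillating test (interval
arithmetic for the digamma/Bombieri integral), which is out of scope for this cycle; obstruction recorded,
not attempted. [folklore] -/
theorem signCone_false_without_signs : ¬ SignConeNoSigns := by
  sorry

end Summit.RiemannHypothesis.RiemannHypothesis.Cruxes.SignConeFarField.Disproof

end
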